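import Summits.QuantumFields.YangMills.Theorems.UnitScaleTiltProp7LiftOfRSEqPrintProjector
import Summits.QuantumFields.YangMills.Theorems.UnitScaleTiltProp7LaplaceAFlatCoercive
import Summits.QuantumFields.YangMills.Theorems.UnitScaleTiltProp7NestedMeanParallelLiftGauge
import HarnessLib

/-!
# Route `UnitScaleTilt`, crux K1 «MinimiserStabilityRegPr» (stmt-QuantumFields-19200), EX row `hGF` (curved member) — **STEP I.3 (FLAT) OF LOCATE-L6-ASSEMBLY IN THE TARGET'S
# OWN LETTERS: at `U₀ = 1` the curved target `T_U(A) ≥ γ‖A‖²` of the LOD line holds with print's `k`-∕volume-free `γ_flat = 1∕(4·Cst 3 a₀)`, for EVERY top nested mean `Q″`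
# of record** — the three flat seams (s1)(s2)(s3) are already knit inside ✓`Prop7LaplaceAFlatCoercive.coercive_laplaceA_one`; this file only moves its conclusion from the
# `R_S(1)` letter to the target's `projR (covLapSite 1) Q″` letter through ✓`Prop7LiftOfRSEqPrintProjector.RS_eq_projR_iff_lift` and the Lift property at the trivial background

Cell `ym3-torus` (HUMAN RULING D-0037, YM ladder rung R3 — NOT d = 4, NOT a mass gap, NOT Clay).  Width seat `ym-ust-19200-w5` (gen 13); chair ★`ym-ust-19200-p1` g24
(LOCATE-L6-ASSEMBLY v1 §0∕§1 Step I.3, 19200 evidence #55: «(L4)(L6) w5»; seams (s1)–(s3) listed S-sized).  THEOREMS ONLY (0 `def`, 0 `sorry`); `--supports stmt-QuantumFields-19200 --as helper`,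
count-neutral.  HONEST LABEL (№33 (6)): curved γ-row supplier line (LOD localisation); this is its FLAT input only; nothing of (3.49), Thm 3.3, `h349`, `hGF`, EX or the crux proved.

THE TARGET (LOCATE-L6 §0, verbatim letters): `T_U(A) := re⟪A, DeltaEta U₀ A⟫ + ‖projR (covLapSite U₀) Q″ (DstarL2 U₀ A)‖² + a‖Qk U₀ A‖² ≥ γ‖A‖²` for all `A`, where `Q″` is any
linear top nested covariant mean of record (clause (iv) of ✓`Prop7NSIntertwinerOfRecord.exists_intertwiner_of_regPr`, `ker Q″ ≤ N_S`).  AT `U₀ = 1`: (i) the Lift property holds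
(every section parallel for the averaged trivial background is constant along bonds and lifts to a parallel fine section: ✓`Prop7NestedMeanParallelLift.parallelLift_one` read through
lit ✓`bgUnits_one`); (ii) hence `R_S(1) = projR (covLapSite 1) Q″` by ✓`RS_eq_projR_iff_lift` at the trivially regular `U₀ = 1` (lit ✓`regPr_one`, any window `ε₀ := (10¹²L³)⁻¹`);
(iii) ✓`coercive_laplaceA_one` + ✓`re_inner_laplaceA` give `γ_flat‖A‖² ≤ re⟪A, Δ^η(1)A⟫ + ‖R_S(1)D*₁A‖² + a‖Q_k(1)A‖²` with `γ_flat = 1∕(4·Cst 3 a₀)` at print's coupling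
`a = a₀(c₀∕cB)η⁻³` — substitute (ii).  K- and volume-free on its face.

WHAT IS PROVED (ns `…Theorems.Prop7FlatTargetOfLODLine`).
* ★ `lift_one` — the Lift clause of ✓`RS_eq_projR_iff_lift` at `U₀ = 1` (every member).
* ★★ `RS_one_eq_projR_topMean` — `RS F n K h c₀ cB 1 = projR (covLapSite F n K c₀ 1) Q″` for every `Q″` with clause (iv) at `U₀ = 1` and `ker Q″ ≤ N_S(1)`.
* ★★★ `flat_target_topMean` — Step I.3: `∀ A, (1∕(4·Cst 3 a₀))·‖A‖² ≤ re⟪A, DeltaEta … 1 A⟫ + ‖projR (covLapSite … 1) Q″ (DstarL2 … 1 A)‖² + (a₀(c₀∕cB)(F.L^(K−n))³)·‖Qk … 1 A‖²`.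
WHY IT MIGHT FAIL: nothing — by-name bookkeeping; the only content is «Lift holds at the trivial background», already a tree theorem.

References: T. Bałaban, CMP **99** (1985) 389–434 [Balaban1985BackgroundPropagators] ((3.20)–(3.23) p.394, (3.26) p.395, Thm 3.11 p.416); CMP **95** (1984) 17–40
[Balaban1984PropagatorsI] (Prop. 1.1 (1.90) p.33).
-/

set_option autoImplicit false

noncomputable section

open scoped InnerProductSpace ComplexConjugate Matrix.Norms.L2Operator BigOperators

namespace Summit.QuantumFields.YangMills.Theorems.Prop7FlatTargetOfLODLine

open Literature.MathematicalPhysics.QuantumFieldTheory.Balaban1983to89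
open Literature.MathematicalPhysics.QuantumFieldTheory.Balaban1983to89.T3ContinuumYM3Torus
open T4Continuum BlockAveraging
open BlockAveraging (Idx)
open B7Prop1Explicit (disp)
open B10Eq27TorusAxialLog (holT transl)
open B7TransferAnalyticMean (meanCLM)
open B11Eq103H1Complex (SiteL2K BondL2K projR)
open B15DeterminingSets (embIter)
open Summit.QuantumFields.YangMills.Theorems.Prop8Chart (emlIterU)
open T3PrintedRegularMinimiser (RegPr regPr_one)
open T3SectALandauChart (bgUnits bgUnits_one)
open Summit.QuantumFields.YangMills.Theorems.Prop7SectET3Transport (periodsT3)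
open Summit.QuantumFields.YangMills.Theorems.Prop7SectET3HilbertLetters (W₂ toL2S DL2 DstarL2 covLapSite)
open Summit.QuantumFields.YangMills.Theorems.Prop7SectET3GaugeProjector (NS RS)
open Summit.QuantumFields.YangMills.Theorems.Prop7SectET3WilsonHessian (DeltaEta)
open Summit.QuantumFields.YangMills.Theorems.Prop7SectET3CurvedPropagators (Qk laplaceA)
open Summit.QuantumFields.YangMills.Theorems.Prop7LiftOfRSEqPrintProjector (RS_eq_projR_iff_lift)
open Summit.QuantumFields.YangMills.Theorems.Prop7LaplaceAFlatCoercive (coercive_laplaceA_one re_inner_laplaceA)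
open Summit.QuantumFields.YangMills.Theorems.Prop7NestedMeanParallelLift (parallelLift_one)

variable {F : T3Family} {n K : ℕ} {h : n ≤ K} {c₀ cB : ℝ} [Fact (0 < c₀)] [Fact (0 < cB)]

omit [Fact (0 < c₀)] [Fact (0 < cB)] in
/-- ★ **THE LIFT PROPERTY AT THE TRIVIAL BACKGROUND** (the Lift clause of ✓`RS_eq_projR_iff_lift` at `U₀ = 1`): every coarse section parallel for the averaged trivial background
lifts to a parallel fine section — ✓`parallelLift_one` read through `bgUnits F K 1 = 1`. [cite: Balaban1985BackgroundPropagators, (3.20)-(3.23) p.394] -/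
theorem lift_one :
    ∀ cf : Site (F.P K) (K - n) → Matrix (Fin 2) (Fin 2) ℂ,
      (∀ e : PBond (F.P K) (K - n), cf e.src =
          ((emlIterU (K - n) (bgUnits F K (1 : GaugeField (F.P K) 0 (Matrix.specialUnitaryGroup (Fin 2) ℂ))) e : (Matrix (Fin 2) (Fin 2) ℂ)ˣ) : Matrix (Fin 2) (Fin 2) ℂ) * cf e.tgt *
          (((emlIterU (K - n) (bgUnits F K (1 : GaugeField (F.P K) 0 (Matrix.specialUnitaryGroup (Fin 2) ℂ))) e)⁻¹ : (Matrix (Fin 2) (Fin 2) ℂ)ˣ) : Matrix (Fin 2) (Fin 2) ℂ)) →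
      ∃ l₀ : Site (F.P K) 0 → Matrix (Fin 2) (Fin 2) ℂ,
        (∀ b : PBond (F.P K) 0, l₀ b.src =
            ((bgUnits F K (1 : GaugeField (F.P K) 0 (Matrix.specialUnitaryGroup (Fin 2) ℂ)) b : (Matrix (Fin 2) (Fin 2) ℂ)ˣ) : Matrix (Fin 2) (Fin 2) ℂ) * l₀ b.tgt *
            (((bgUnits F K (1 : GaugeField (F.P K) 0 (Matrix.specialUnitaryGroup (Fin 2) ℂ)) b)⁻¹ : (Matrix (Fin 2) (Fin 2) ℂ)ˣ) : Matrix (Fin 2) (Fin 2) ℂ)) ∧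
        ∀ y : Site (F.P K) (K - n), l₀ (embIter (K - n) y) = cf y := by
  rw [bgUnits_one]
  exact parallelLift_one (K - n)

omit [Fact (0 < cB)] in
/-- ★★ **AT THE FLAT MEMBER THE INTRINSIC PROJECTOR IS PRINT'S PROJECTOR FOR EVERY TOP MEAN OF RECORD**: `R_S(1) = projR (covLapSite 1) Q″` whenever `Q″` has the top-mean
clause (iv) at `U₀ = 1` and `ker Q″ ≤ N_S(1)` — ✓`RS_eq_projR_iff_lift` at the trivially regular background (✓`regPr_one` at the window `ε₀ := (10¹²L³)⁻¹`) fed by `lift_one`.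
[cite: Balaban1985BackgroundPropagators, (3.20)-(3.23) p.394, (3.115) p.418] -/
theorem RS_one_eq_projR_topMean
    (Q'' : SiteL2K ℂ 3 (periodsT3 F K) c₀ W₂ →ₗ[ℂ] (Site (F.P K) (K - n) → Matrix (Fin 2) (Fin 2) ℂ))
    (htop : ∀ (lam : Site (F.P K) 0 → Matrix (Fin 2) (Fin 2) ℂ) (ns : (j : ℕ) → Site (F.P K) j → Matrix (Fin 2) (Fin 2) ℂ), ns 0 = lam →
      (∀ (j : ℕ) (y : Site (F.P K) (j + 1)), ns (j + 1) y = ns j (emb y) - meanCLM (Idx (F.P K)) (Matrix (Fin 2) (Fin 2) ℂ) fun i : Idx (F.P K) =>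
        ns j (emb y) - ((holT (emlIterU j (bgUnits F K (1 : GaugeField (F.P K) 0 (Matrix.specialUnitaryGroup (Fin 2) ℂ)))) (emb y) (stairWord i.2.1 (off i.1)) : (Matrix (Fin 2) (Fin 2) ℂ)ˣ) : Matrix (Fin 2) (Fin 2) ℂ) *
          ns j (transl (emb y) (disp (stairWord i.2.1 (off i.1)))) *
          (((holT (emlIterU j (bgUnits F K (1 : GaugeField (F.P K) 0 (Matrix.specialUnitaryGroup (Fin 2) ℂ)))) (emb y) (stairWord i.2.1 (off i.1)))⁻¹ : (Matrix (Fin 2) (Fin 2) ℂ)ˣ) : Matrix (Fin 2) (Fin 2) ℂ)) →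
      ns (K - n) = Q'' (toL2S F K c₀ lam))
    (hker : LinearMap.ker Q'' ≤ NS F n K h c₀ cB (1 : GaugeField (F.P K) 0 (Matrix.specialUnitaryGroup (Fin 2) ℂ))) :
    RS F n K h c₀ cB (1 : GaugeField (F.P K) 0 (Matrix.specialUnitaryGroup (Fin 2) ℂ))
      = projR (covLapSite F n K c₀ (1 : GaugeField (F.P K) 0 (Matrix.specialUnitaryGroup (Fin 2) ℂ))) Q'' := by
  -- a window: `ε₀ := (10¹² L³)⁻¹`
  have hL : (0 : ℝ) < (F.L : ℝ) := by have := F.hL.2; exact_mod_cast (by omega : 0 < F.L)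
  have hD : (0 : ℝ) < 10 ^ 12 * (F.L : ℝ) ^ 3 := by positivity
  have hε₀ : (0 : ℝ) < (10 ^ 12 * (F.L : ℝ) ^ 3)⁻¹ := inv_pos.2 hD
  have hWε : 10 ^ 12 * (F.L : ℝ) ^ 3 * (10 ^ 12 * (F.L : ℝ) ^ 3)⁻¹ ≤ 1 := by rw [mul_inv_cancel₀ hD.ne']
  exact (RS_eq_projR_iff_lift (F := F) h cB hε₀ hWε 1 (regPr_one hε₀) Q'' htop hker).2 lift_one

/-- ★★★ **STEP I.3 (FLAT) OF LOCATE-L6-ASSEMBLY, TARGET LETTERS**: at `U₀ = 1`, for every `a₀ > 0`, print's coupling `a = a₀(c₀∕cB)η⁻³` and every top nested mean `Q″` of record,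
`(1∕(4·Cst 3 a₀))·‖A‖² ≤ re⟪A, Δ^η(1)A⟫ + ‖projR (covLapSite 1) Q″ (D*₁A)‖² + a·‖Q_k(1)A‖²` for all `A` — the curved target `T_U(A) ≥ γ‖A‖²` AT THE FLAT MEMBER with the
`k`-∕volume-free `γ_flat` ([B4] (1.90) ⟶ ✓`flat_coercive_R_T3` ⟶ ✓`coercive_laplaceA_one`, seams (s1)–(s3) inside), moved to the `projR … Q″` letter by `RS_one_eq_projR_topMean`.
[cite: Balaban1984PropagatorsI, Prop. 1.1 (1.90) p.33; Balaban1985BackgroundPropagators, (3.26) p.395, Thm 3.11 p.416] -/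
theorem flat_target_topMean {a₀ : ℝ} (ha₀ : 0 < a₀)
    (Q'' : SiteL2K ℂ 3 (periodsT3 F K) c₀ W₂ →ₗ[ℂ] (Site (F.P K) (K - n) → Matrix (Fin 2) (Fin 2) ℂ))
    (htop : ∀ (lam : Site (F.P K) 0 → Matrix (Fin 2) (Fin 2) ℂ) (ns : (j : ℕ) → Site (F.P K) j → Matrix (Fin 2) (Fin 2) ℂ), ns 0 = lam →
      (∀ (j : ℕ) (y : Site (F.P K) (j + 1)), ns (j + 1) y = ns j (emb y) - meanCLM (Idx (F.P K)) (Matrix (Fin 2) (Fin 2) ℂ) fun i : Idx (F.P K) =>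
        ns j (emb y) - ((holT (emlIterU j (bgUnits F K (1 : GaugeField (F.P K) 0 (Matrix.specialUnitaryGroup (Fin 2) ℂ)))) (emb y) (stairWord i.2.1 (off i.1)) : (Matrix (Fin 2) (Fin 2) ℂ)ˣ) : Matrix (Fin 2) (Fin 2) ℂ) *
          ns j (transl (emb y) (disp (stairWord i.2.1 (off i.1)))) *
          (((holT (emlIterU j (bgUnits F K (1 : GaugeField (F.P K) 0 (Matrix.specialUnitaryGroup (Fin 2) ℂ)))) (emb y) (stairWord i.2.1 (off i.1)))⁻¹ : (Matrix (Fin 2) (Fin 2) ℂ)ˣ) : Matrix (Fin 2) (Fin 2) ℂ)) →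
      ns (K - n) = Q'' (toL2S F K c₀ lam))
    (hker : LinearMap.ker Q'' ≤ NS F n K h c₀ cB (1 : GaugeField (F.P K) 0 (Matrix.specialUnitaryGroup (Fin 2) ℂ))) :
    ∀ A : BondL2K ℂ 3 (periodsT3 F K) c₀ W₂,
      (1 / (4 * B5Prop11Plancherel.Cst 3 a₀)) * ‖A‖ ^ 2
        ≤ RCLike.re ⟪A, DeltaEta F n K c₀ 1 A⟫_ℂ
          + ‖projR (covLapSite F n K c₀ (1 : GaugeField (F.P K) 0 (Matrix.specialUnitaryGroup (Fin 2) ℂ))) Q'' (DstarL2 F n K c₀ 1 A)‖ ^ 2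
          + (a₀ * (c₀ / cB) * ((F.L : ℝ) ^ (K - n)) ^ 3) * ‖Qk F n K h c₀ cB 1 A‖ ^ 2 := by
  intro A
  have h1 := coercive_laplaceA_one (h := h) (cB := cB) ha₀
    (fun U₀ => (DeltaEta F n K c₀ U₀ : BondL2K ℂ 3 (periodsT3 F K) c₀ W₂ →ₗ[ℂ] BondL2K ℂ 3 (periodsT3 F K) c₀ W₂)) rfl A
  rw [re_inner_laplaceA, RS_one_eq_projR_topMean (h := h) (cB := cB) Q'' htop hker] at h1
  exact h1

end Summit.QuantumFields.YangMills.Theorems.Prop7FlatTargetOfLODLine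

end
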